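import Summits.Ventures.PercRepro.C026PendantProbeCounts
import Summits.Ventures.PercRepro.C026ClassEdge

/-!
# `(E00)` is invariant under a pendant probe (p6, gen 20)

mine-3's observation (§35 (d)): «`(E00)` is invariant under adding a pendant probe».  In the tree's
vocabulary: if the probe `c` is **pendant**, its only edge being `e = c–u` (`u ≠ c`, and `c` not a
live vertex), then the corner identity of the skeleton `(G; a, b, c)` holds iff it holds for the
skeleton `(G; a, b, u)` — the same multigraph with the probe moved to `u` (`e` is then a bare leaf,
which only doubles every count):

  `pFun_liveCells_nonneg_iff_of_pendant_probe :  (E00)(G; a, b, c) ↔ (E00)(G; a, b, u)`.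

PROOF (counts over `Config E`; `n_c`, `n_u` = the type counts with probe `c`, `u`). Every `c`-count
needs `c` red-joined to a live vertex, hence `e` red; with `e` red, `c ~ x` iff `u ~ x` in red and `c`
is blue-isolated, so the `c`-types are read off the `u`-types: `n_c(D,A) = U(D, a ≁_b b)`, `|B|_c = U(B)`,
`n_c(B,C) = U(B, a ~_b b)`, `n_c(D,¬A) = U(D, a ~_b b)`, where `U(·)` counts the configurations with `e`
red.  The state of `e` never matters for a connection between vertices other than `c`
(`conn_update_iff_of_ne`), so flipping `e` is a type-preserving involution and every `u`-count is
`2·U(·)`; complementation followed by re-opening `e` swaps red and blue on the `e`-red configurations,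
so `U(D,B) = U(B,D)`.  Substituting, both `(E00)`'s read
`U(D,A) ≤ 2 U(B) + 2 U(B,C) + U(B,D) + U(D, a ~_b b)`.

COROLLARIES: THEOREM L2 composes with a pendant probe (`pFun_threeCells_nonneg_of_pendant_probe`:
`(E00)(G; a, b, u)` gives `(P) ≥ 0` at every band state of the skeleton with probe `c`), in particular
on every skeleton whose probe is pendant at `u` with `u` joined to a live vertex by an edge, or with a
pendant live vertex.
-/

namespace PercRepro

namespace MultiGraph

open Finset

variable {V E : Type*} {G : MultiGraph V E}

section Pendant

variable [DecidableEq E] {e : E} {c u : V}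

section Count

variable [Fintype E]

variable [Fintype V] [DecidableEq V]

section Identities

variable (hleaf : ∀ f, G.fst f = c ∨ G.snd f = c → f = e)
  (hend : (G.fst e = c ∧ G.snd e = u) ∨ (G.fst e = u ∧ G.snd e = c)) (hcu : u ≠ c)
  {a b : V} (hac : a ≠ c) (hbc : b ≠ c)
include hleaf hend hcu hac hbc

open Classical in
/-- **`(E00)` is invariant under a pendant probe**: if the only edge at the probe `c` is `e = c–u`
(`u ≠ c`, `a ≠ c`, `b ≠ c`), the corner identity of `(G; a, b, c)` holds iff that of `(G; a, b, u)`
does. -/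
theorem pFun_liveCells_nonneg_iff_of_pendant_probe :
    0 ≤ G.pFun c (liveCells a b) (liveCells a b) univ ↔
      0 ≤ G.pFun u (liveCells a b) (liveCells a b) univ := by
  rw [pFun_liveCells_nonneg_iff, pFun_liveCells_nonneg_iff,
    filter_DA_c_eq hleaf hend hac hbc, filter_B_c_eq hleaf hend hac hbc,
    filter_BC_c_eq hleaf hend hac hbc, filter_DnA_c_eq hleaf hend hac hbc,
    card_DA_u_eq hleaf hend hcu hac hbc, card_B_u_eq hleaf hend hcu hac hbc,
    card_BC_u_eq hleaf hend hcu hac hbc, card_DnA_u_eq hleaf hend hcu hac hbc]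
  have h1 := card_D_notab_split (G := G) (e := e) (u := u) (a := a) (b := b)
  have h2 := card_D_notA_split (G := G) (e := e) (u := u) (a := a) (b := b)
  have h3 := card_B_ab_split (G := G) (e := e) (u := u) (a := a) (b := b)
  have h4 := card_DB_eq_card_BD hleaf hend hcu hac hbc
  omega

/-- **THEOREM L2 transfers along a pendant probe**: if `(E00)` holds for the skeleton with probe `u`,
then `(P) ≥ 0` at every band state of the skeleton with the pendant probe `c` and the two live
vertices. -/
theorem pFun_threeCells_nonneg_of_pendant_probe
    (hu : 0 ≤ G.pFun u (liveCells a b) (liveCells a b) univ) {z κ x₁ K₁ x₂ K₂ : ℝ}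
    (hz : 0 ≤ z ∧ z ≤ 1) (hκ : kMin z ≤ κ) (hx₁ : 0 ≤ x₁ ∧ x₁ ≤ 1) (hx₂ : 0 ≤ x₂ ∧ x₂ ≤ 1)
    (hK₁ : kMin x₁ ≤ K₁) (hK₂ : kMin x₂ ≤ K₂) :
    0 ≤ G.pFun c (threeCells c a b z x₁ x₂) (threeCells c a b κ K₁ K₂) univ :=
  pFun_threeCells_nonneg_of_E00 c a b hz hκ hx₁ hx₂ hK₁ hK₂
    ((pFun_liveCells_nonneg_iff_of_pendant_probe hleaf hend hcu hac hbc).2 hu)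

/-- **THEOREM L2 on a pendant probe whose neighbour is joined to a live vertex**: if the only edge
at `c` is `c–u` and some edge joins `u` and `a`, then `(P) ≥ 0` at every band state (p5's `(CF)` class
on the skeleton with probe `u`, transferred along the pendant edge). -/
theorem pFun_threeCells_nonneg_of_pendant_probe_edge (f : E)
    (hf : (G.fst f = u ∧ G.snd f = a) ∨ (G.fst f = a ∧ G.snd f = u)) {z κ x₁ K₁ x₂ K₂ : ℝ}
    (hz : 0 ≤ z ∧ z ≤ 1) (hκ : kMin z ≤ κ) (hx₁ : 0 ≤ x₁ ∧ x₁ ≤ 1) (hx₂ : 0 ≤ x₂ ∧ x₂ ≤ 1)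
    (hK₁ : kMin x₁ ≤ K₁) (hK₂ : kMin x₂ ≤ K₂) :
    0 ≤ G.pFun c (threeCells c a b z x₁ x₂) (threeCells c a b κ K₁ K₂) univ :=
  pFun_threeCells_nonneg_of_pendant_probe hleaf hend hcu hac hbc
    (pFun_liveCells_nonneg_of_slackCF a b u (G.slackCF_nonneg_of_edge f hf)) hz hκ hx₁ hx₂ hK₁ hK₂

/-- **THEOREM L2 on a pendant probe with a pendant live vertex**: if the only edge at `c` is `c–u`
and the only edge at `a` is `f`, then `(P) ≥ 0` at every band state. -/
theorem pFun_threeCells_nonneg_of_pendant_probe_leaf (f : E)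
    (hleafa : ∀ g, G.fst g = a ∨ G.snd g = a → g = f) {z κ x₁ K₁ x₂ K₂ : ℝ}
    (hz : 0 ≤ z ∧ z ≤ 1) (hκ : kMin z ≤ κ) (hx₁ : 0 ≤ x₁ ∧ x₁ ≤ 1) (hx₂ : 0 ≤ x₂ ∧ x₂ ≤ 1)
    (hK₁ : kMin x₁ ≤ K₁) (hK₂ : kMin x₂ ≤ K₂) :
    0 ≤ G.pFun c (threeCells c a b z x₁ x₂) (threeCells c a b κ K₁ K₂) univ :=
  pFun_threeCells_nonneg_of_pendant_probe hleaf hend hcu hac hbc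
    (pFun_liveCells_nonneg_of_leaf a b u f hleafa) hz hκ hx₁ hx₂ hK₁ hK₂

end Identities

end Count

end Pendant

end MultiGraph

end PercRepro
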